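import Summits.PneNP.PneNP.Theorems.ConvexRankGatesConvexGateBlindXorDefs

/-!
# The minimal explicit instance of the strict-rank jump, I: the instance, its junta factorisation, its rectangles

Support file for crux `ConvexGateBlind` (stmt-PneNP-10680), line `xor-door-perfect-completeness`, open stub
`stub_exactLifting` (an ε-free statement about the STRICT non-negative rank `rk₊₊`, Hrubeš 2020, of Index-lifts;
classified by every seat as an explicit instance of Hrubeš's Open Problem 4). Memo `STRICTRANK-MINIMAL-seat3.md`.

The smallest matrix family on which the phenomenon the stub needs can occur at all: the odd triangle of 2-XOR
constraints `{y₀ ≠ y₁, y₁ ≠ y₂, y₀ ≠ y₂}` (2-colouring of `K₃`, unsatisfiable) lifted by the Index gadget of size `t`: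
rows `x : Fin 3 → Fin t → Bool` (2-colourings of three blocks of `t` vertices), columns `w : Fin 3 → Fin t`
(transversal triangles), `triLift t x w = #{agreeing pairs among x₀(w₀), x₁(w₁), x₂(w₂)} = 1 + 2·[w monochromatic
under x] ∈ {1,3}` (`agree_eq`).

* §1 `hasConeFact_triLift` / registered sub-goal `minimal_instance_junta` — the ε = 0 endpoint is cheap:
  `triLift t = Σ_{i<j} lift[y_i = y_j]` is a sum of `3t²` non-negative rank-one 0/1 matrices, `rk₊(M_t) ≤ 3t²`.
* §2 `two_mul_card_rect_le` — every 1-rectangle `S × W` of `E_t = [w monochromatic under x] = (M_t − J)/2` has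
  `2·|S|·|W| ≤ N = #rows`: flipping the row bits on arbitrary subsets of the values that `W` touches in two of the
  three coordinates is injective on `S × 2^{P_i} × 2^{P_j}` (`flip2_injOn`: the untouched third coordinate of a
  triangle through a touched value remembers the original common bit), so `|S|·2^{k_i+k_j} ≤ N`, while `|W| ≤ k₀k₁k₂`
  and `2·k₀k₁k₂ ≤ 2^{k_i+k_j}` for `k_m` minimal (`two_mul_mul_mul_le_two_pow`).

Part II (`…MinimalInstanceCover.lean`) counts and covers the ones of `E_t` and concludes `rk₊(M_t − J) ≥ t³/2`
(registered sub-goal `minimal_instance_endpoints`). Nothing here bears logically on `ExactLifting` (the instance is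
only 2-fooled); it fixes the first TECHNIQUE target: `rk₊(M_t) = Θ(t²)`, `rk₊(M_t − J) = Θ(t³)`, and the strict rank
`rk₊₊(M_t) = lim_{ε→0+} rk₊(M_t − εJ) ± 1 ∈ [3t² − 3t + 1, t³ + 1]` is the open question.
-/

set_option linter.dupNamespace false -- `Summit.PneNP.PneNP.…`: summit = sub-problem (D-0017)

namespace Summit.PneNP.PneNP.Theorems.XorDoor.Minimal

open scoped BigOperators Classical
open Finset

noncomputable section

variable {t : ℕ}

/-- Rows of the minimal instance: 2-colourings of three blocks of `t` vertices. -/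
abbrev Row (t : ℕ) : Type := Fin 3 → Fin t → Bool

/-- Columns of the minimal instance: transversal triangles (one pointer per block). -/
abbrev Col (t : ℕ) : Type := Fin 3 → Fin t

/-- The planted triangle `w` is monochromatic under the colouring `x`. -/
def Mono (x : Row t) (w : Col t) : Prop := x 0 (w 0) = x 1 (w 1) ∧ x 1 (w 1) = x 2 (w 2)

/-- The number of agreeing pairs among the three pointed bits (= the number of violated constraints of the
planted odd triangle `{y₀ ≠ y₁, y₁ ≠ y₂, y₀ ≠ y₂}`). -/
def agree (x : Row t) (w : Col t) : ℕ :=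
  (if x 0 (w 0) = x 1 (w 1) then 1 else 0) + (if x 1 (w 1) = x 2 (w 2) then 1 else 0) +
    (if x 0 (w 0) = x 2 (w 2) then 1 else 0)

/-- The minimal instance `M_t[x,w] = #agreeing pairs ∈ {1,3}` as a real matrix. -/
def triLift (t : ℕ) (x : Row t) (w : Col t) : ℝ := (agree x w : ℝ)

/-- `M_t = 1 + 2·[monochromatic]`: three bits either all agree (3 pairs) or exactly one pair agrees. -/
theorem agree_eq (x : Row t) (w : Col t) : agree x w = if Mono x w then 3 else 1 := by
  unfold agree Mono
  generalize x 0 (w 0) = a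
  generalize x 1 (w 1) = b
  generalize x 2 (w 2) = c
  cases a <;> cases b <;> cases c <;> simp

/-- Real form of `agree_eq`. -/
theorem triLift_eq (x : Row t) (w : Col t) : triLift t x w = if Mono x w then 3 else 1 := by
  unfold triLift
  rw [agree_eq]
  split_ifs <;> simp

/-- A monochromatic triangle has all three pointed bits equal. -/
theorem Mono.all_eq {x : Row t} {w : Col t} (h : Mono x w) : ∀ a b : Fin 3, x a (w a) = x b (w b) := by
  obtain ⟨h01, h12⟩ := h
  intro a b
  fin_cases a <;> fin_cases b <;> simp [h01, h12]

/-! ## §1 The ε = 0 endpoint: the junta factorisation, `rk₊(M_t) ≤ 3t²` -/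

/-- The three pairs `{0,1}, {1,2}, {0,2}` of coordinates. -/
def pairs : Fin 3 → Fin 3 × Fin 3 := ![(0, 1), (1, 2), (0, 2)]

/-- Index set of the junta factorisation: (pair, pointer, pointer). -/
def idx (t : ℕ) : Fin (3 * (t * t)) ≃ Fin 3 × (Fin t × Fin t) :=
  finProdFinEquiv.symm.trans (Equiv.prodCongr (Equiv.refl _) finProdFinEquiv.symm)

/-- Row factors of the junta factorisation: `[x_i(p) = x_j(q)]`. -/
def juntaU (t : ℕ) (x : Row t) (l : Fin (3 * (t * t))) : ℝ :=
  if x (pairs (idx t l).1).1 (idx t l).2.1 = x (pairs (idx t l).1).2 (idx t l).2.2 then 1 else 0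

/-- Column factors of the junta factorisation: the cylinder `[w_i = p ∧ w_j = q]`. -/
def juntaV (t : ℕ) (l : Fin (3 * (t * t))) (w : Col t) : ℝ :=
  if w (pairs (idx t l).1).1 = (idx t l).2.1 ∧ w (pairs (idx t l).1).2 = (idx t l).2.2 then 1 else 0

/-- The cylinder sum over one pair of coordinates collapses to the agreement indicator of that pair. -/
theorem sum_pair_collapse (x : Row t) (w : Col t) (i j : Fin 3) :
    ∑ p : Fin t, ∑ q : Fin t,
      (if x i p = x j q then (1 : ℝ) else 0) * (if w i = p ∧ w j = q then (1 : ℝ) else 0) =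
      if x i (w i) = x j (w j) then 1 else 0 := by
  rw [Finset.sum_eq_single (w i)]
  · rw [Finset.sum_eq_single (w j)]
    · simp
    · intro q _ hq
      have hne : w j ≠ q := fun h => hq h.symm
      simp [hne]
    · intro h; exact absurd (Finset.mem_univ _) h
  · intro p _ hp
    apply Finset.sum_eq_zero
    intro q _
    have hne : w i ≠ p := fun h => hp h.symm
    simp [hne]
  · intro h; exact absurd (Finset.mem_univ _) h

/-- **The ε = 0 endpoint.** `M_t` is a sum of `3t²` non-negative rank-one 0/1 matrices (cone factorisation
through `ℝ^{3t²}_{≥0}`, no PSD part): `rk₊(M_t) ≤ 3t²`. -/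
theorem hasConeFact_triLift (t : ℕ) : HasConeFact (triLift t) 0 (3 * (t * t)) := by
  refine ⟨fun _ => 0, fun _ => 0, juntaU t, juntaV t, fun _ => Matrix.PosSemidef.zero,
    fun _ => Matrix.PosSemidef.zero, ?_, ?_, ?_⟩
  · intro x l; unfold juntaU; split_ifs <;> norm_num
  · intro l w; unfold juntaV; split_ifs <;> norm_num
  · intro x w
    show triLift t x w = ((0 : Matrix (Fin 0) (Fin 0) ℝ) * 0).trace + ∑ l, juntaU t x l * juntaV t l w
    have htr : ((0 : Matrix (Fin 0) (Fin 0) ℝ) * 0).trace = 0 := by simp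
    rw [htr, zero_add]
    -- reindex the sum by (pair, p, q)
    have hre : ∑ l : Fin (3 * (t * t)), juntaU t x l * juntaV t l w =
        ∑ k : Fin 3 × (Fin t × Fin t),
          (if x (pairs k.1).1 k.2.1 = x (pairs k.1).2 k.2.2 then (1 : ℝ) else 0) *
            (if w (pairs k.1).1 = k.2.1 ∧ w (pairs k.1).2 = k.2.2 then (1 : ℝ) else 0) := by
      refine Fintype.sum_equiv (idx t) _ _ (fun l => ?_)
      rfl
    rw [hre, Fintype.sum_prod_type, Fin.sum_univ_three]
    simp only [Fintype.sum_prod_type, sum_pair_collapse]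
    simp [triLift, agree, pairs]
    split_ifs <;> norm_num

/-! ## §2 The ε = 1 endpoint: every 1-rectangle of `E_t` is small -/

/-- Flip the row bits of `x` on the values `F` in coordinate `i` and on the values `G` in coordinate `j`. -/
def flip2 (i j : Fin 3) (F G : Finset (Fin t)) (x : Row t) : Row t :=
  fun a v => if (a = i ∧ v ∈ F) ∨ (a = j ∧ v ∈ G) then !(x a v) else x a v

/-- Unflipped coordinates are untouched by `flip2`. -/
theorem flip2_apply_of_ne {i j a : Fin 3} (F G : Finset (Fin t)) (x : Row t) (hai : a ≠ i) (haj : a ≠ j)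
    (v : Fin t) : flip2 i j F G x a v = x a v := by
  simp [flip2, hai, haj]

/-- Value of `flip2` in the first flipped coordinate. -/
theorem flip2_apply_left {i j : Fin 3} (hij : i ≠ j) (F G : Finset (Fin t)) (x : Row t) (v : Fin t) :
    flip2 i j F G x i v = if v ∈ F then !(x i v) else x i v := by
  simp [flip2, hij]

/-- Value of `flip2` in the second flipped coordinate. -/
theorem flip2_apply_right {i j : Fin 3} (hij : i ≠ j) (F G : Finset (Fin t)) (x : Row t) (v : Fin t) :
    flip2 i j F G x j v = if v ∈ G then !(x j v) else x j v := by
  simp [flip2, hij.symm]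

/-- Undoing: `flip2` with the same sets is an involution, hence injective in `x`. -/
theorem flip2_flip2 (i j : Fin 3) (F G : Finset (Fin t)) (x : Row t) :
    flip2 i j F G (flip2 i j F G x) = x := by
  funext a v
  simp only [flip2]
  split_ifs <;> simp

/-- **Decoding lemma.** On rows that are constant on every triangle of `W`, the map
`(x, F, G) ↦ flip2 i j F G x` (`F ⊆` values touched by `W` in coordinate `i`, `G ⊆` those in coordinate `j`) is
injective: for a touched value `v = w i`, the third coordinate `m` of `w` is never flipped, so
`v ∈ F ↔ (flipped row differs at (i, v) and (m, w m))`. -/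
theorem flip2_injOn (i j m : Fin 3) (him : m ≠ i) (hjm : m ≠ j) (hij : i ≠ j)
    (S : Finset (Row t)) (W : Finset (Col t))
    (hS : ∀ x ∈ S, ∀ w ∈ W, ∀ a b : Fin 3, x a (w a) = x b (w b)) :
    Set.InjOn (fun p : Row t × (Finset (Fin t) × Finset (Fin t)) => flip2 i j p.2.1 p.2.2 p.1)
      ↑(S ×ˢ ((W.image fun w => w i).powerset ×ˢ (W.image fun w => w j).powerset)) := by
  -- the key equivalence, for any admissible triple
  have aux : ∀ (y : Row t) (Fy Gy : Finset (Fin t)), y ∈ S → ∀ w ∈ W,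
      (w i ∈ Fy ↔ flip2 i j Fy Gy y i (w i) ≠ flip2 i j Fy Gy y m (w m)) ∧
      (w j ∈ Gy ↔ flip2 i j Fy Gy y j (w j) ≠ flip2 i j Fy Gy y m (w m)) := by
    intro y Fy Gy hy w hw
    have em : flip2 i j Fy Gy y m (w m) = y m (w m) := flip2_apply_of_ne Fy Gy y him hjm (w m)
    have ei : flip2 i j Fy Gy y i (w i) = if w i ∈ Fy then !(y i (w i)) else y i (w i) :=
      flip2_apply_left hij Fy Gy y (w i)
    have ej : flip2 i j Fy Gy y j (w j) = if w j ∈ Gy then !(y j (w j)) else y j (w j) :=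
      flip2_apply_right hij Fy Gy y (w j)
    have yi : y i (w i) = y m (w m) := hS y hy w hw i m
    have yj : y j (w j) = y m (w m) := hS y hy w hw j m
    refine ⟨?_, ?_⟩
    · rw [em, ei, yi]
      by_cases hmem : w i ∈ Fy
      · simp only [hmem, if_true, true_iff]
        cases y m (w m) <;> simp
      · simp [hmem]
    · rw [em, ej, yj]
      by_cases hmem : w j ∈ Gy
      · simp only [hmem, if_true, true_iff]
        cases y m (w m) <;> simp
      · simp [hmem]
  rintro ⟨x, F, G⟩ hx ⟨x', F', G'⟩ hx' heq
  simp only [Finset.mem_coe, Finset.mem_product, Finset.mem_powerset] at hx hx'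
  obtain ⟨hxS, hF, hG⟩ := hx
  obtain ⟨hxS', hF', hG'⟩ := hx'
  have heq' : flip2 i j F G x = flip2 i j F' G' x' := heq
  -- the flipped sets agree
  have hFF : F = F' := by
    ext v
    constructor
    · intro hv
      obtain ⟨w, hw, rfl⟩ := Finset.mem_image.1 (hF hv)
      have h1 := ((aux x F G hxS w hw).1).1 hv
      rw [heq'] at h1
      exact ((aux x' F' G' hxS' w hw).1).2 h1
    · intro hv
      obtain ⟨w, hw, rfl⟩ := Finset.mem_image.1 (hF' hv)
      have h1 := ((aux x' F' G' hxS' w hw).1).1 hv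
      rw [← heq'] at h1
      exact ((aux x F G hxS w hw).1).2 h1
  have hGG : G = G' := by
    ext v
    constructor
    · intro hv
      obtain ⟨w, hw, rfl⟩ := Finset.mem_image.1 (hG hv)
      have h1 := ((aux x F G hxS w hw).2).1 hv
      rw [heq'] at h1
      exact ((aux x' F' G' hxS' w hw).2).2 h1
    · intro hv
      obtain ⟨w, hw, rfl⟩ := Finset.mem_image.1 (hG' hv)
      have h1 := ((aux x' F' G' hxS' w hw).2).1 hv
      rw [← heq'] at h1
      exact ((aux x F G hxS w hw).2).2 h1
  subst hFF; subst hGG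
  -- and then the rows agree (flip2 is an involution)
  have hxx : x = x' := by
    have h2 := congrArg (flip2 i j F G) heq'
    rwa [flip2_flip2, flip2_flip2] at h2
  subst hxx
  rfl

/-- Cardinality form of the decoding lemma: `|S| · 2^{k_i} · 2^{k_j} ≤ N`. -/
theorem card_mul_two_pow_le (i j m : Fin 3) (him : m ≠ i) (hjm : m ≠ j) (hij : i ≠ j)
    (S : Finset (Row t)) (W : Finset (Col t))
    (hS : ∀ x ∈ S, ∀ w ∈ W, ∀ a b : Fin 3, x a (w a) = x b (w b)) :
    S.card * (2 ^ (W.image fun w => w i).card * 2 ^ (W.image fun w => w j).card) ≤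
      Fintype.card (Row t) := by
  have h := Finset.card_le_card_of_injOn
    (s := S ×ˢ ((W.image fun w => w i).powerset ×ˢ (W.image fun w => w j).powerset))
    (t := (Finset.univ : Finset (Row t)))
    (fun p : Row t × (Finset (Fin t) × Finset (Fin t)) => flip2 i j p.2.1 p.2.2 p.1)
    (fun p _ => Finset.mem_coe.2 (Finset.mem_univ _)) (flip2_injOn i j m him hjm hij S W hS)
  simpa [Finset.card_product, Finset.card_powerset, Finset.card_univ] using h

/-- `W` lies in the box of the values it touches: `|W| ≤ k₀ · k₁ · k₂`. -/
theorem card_le_prod_card_image (W : Finset (Col t)) :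
    W.card ≤ (W.image fun w => w 0).card * ((W.image fun w => w 1).card * (W.image fun w => w 2).card) := by
  have h := Finset.card_le_card_of_injOn
    (s := W) (t := (W.image fun w => w 0) ×ˢ ((W.image fun w => w 1) ×ˢ (W.image fun w => w 2)))
    (fun w : Col t => (w 0, (w 1, w 2)))
    (fun w hw => by
      simp only [Finset.coe_product, Set.mem_prod, Finset.mem_coe, Finset.mem_image]
      exact ⟨⟨w, hw, rfl⟩, ⟨w, hw, rfl⟩, ⟨w, hw, rfl⟩⟩)
    (by
      intro w _ w' _ h
      simp only [Prod.mk.injEq] at h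
      funext a
      fin_cases a
      · exact h.1
      · exact h.2.1
      · exact h.2.2)
  simpa [Finset.card_product] using h

/-- Elementary arithmetic: `2abc ≤ 2^{b+c}` whenever `a ≤ b` and `a ≤ c` (maximal ratio `1/2` at `a = b = c = 2`). -/
theorem two_mul_mul_mul_le_two_pow (a b c : ℕ) (hab : a ≤ b) (hac : a ≤ c) :
    2 * (a * (b * c)) ≤ 2 ^ (b + c) := by
  -- 8 b² ≤ 9 · 2^b and 8 c ≤ 3 · 2^c for b, c ≥ 3
  have hb3 : ∀ n : ℕ, 3 ≤ n → 8 * (n * n) ≤ 9 * 2 ^ n := by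
    intro n hn
    induction n, hn using Nat.le_induction with
    | base => norm_num
    | succ k hk ih =>
      have hk2 : 16 * k + 8 ≤ 8 * (k * k) := by nlinarith
      have e : 8 * ((k + 1) * (k + 1)) = 8 * (k * k) + (16 * k + 8) := by ring
      rw [e, pow_succ]
      linarith
  have hc3 : ∀ n : ℕ, 3 ≤ n → 8 * n ≤ 3 * 2 ^ n := by
    intro n hn
    induction n, hn using Nat.le_induction with
    | base => norm_num
    | succ k hk ih =>
      have h8 : 2 ^ 3 ≤ 2 ^ k := Nat.pow_le_pow_right (by norm_num) hk
      rw [pow_succ]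
      norm_num at h8
      linarith
  have h2n : ∀ n : ℕ, 2 * n ≤ 2 ^ n := by
    intro n
    induction n with
    | zero => simp
    | succ k ih =>
      rcases Nat.eq_zero_or_pos k with rfl | hk
      · simp
      · have h2 : 2 ≤ 2 ^ k :=
          calc 2 = 2 ^ 1 := by norm_num
            _ ≤ 2 ^ k := Nat.pow_le_pow_right (by norm_num) hk
        calc 2 * (k + 1) = 2 * k + 2 := by ring
          _ ≤ 2 ^ k + 2 ^ k := by omega
          _ = 2 ^ (k + 1) := by ring
  have h2b := h2n b
  have h2c := h2n c
  have hpb : 1 ≤ 2 ^ b := Nat.one_le_two_pow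
  have hpc : 1 ≤ 2 ^ c := Nat.one_le_two_pow
  rw [pow_add]
  by_cases hb : b ≤ 2
  · -- a ≤ b ≤ 2, c arbitrary: each case is a multiple of 2c ≤ 2^c
    interval_cases b <;> interval_cases a <;> nlinarith [h2c, hpc]
  · by_cases hc : c ≤ 2
    · interval_cases c <;> interval_cases a <;> nlinarith [h2b, hpb]
    · -- b, c ≥ 3: 64 · b²c ≤ (8b²)(8c) ≤ 27 · 2^b 2^c
      have hb' := hb3 b (by omega)
      have hc' := hc3 c (by omega)
      have h1 : a * (b * c) ≤ b * (b * c) := Nat.mul_le_mul_right (b * c) hab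
      have h4 : 64 * (b * (b * c)) ≤ 27 * (2 ^ b * 2 ^ c) := by
        have e1 : 64 * (b * (b * c)) = (8 * (b * b)) * (8 * c) := by ring
        have e2 : (9 * 2 ^ b) * (3 * 2 ^ c) = 27 * (2 ^ b * 2 ^ c) := by ring
        rw [e1, ← e2]
        exact Nat.mul_le_mul hb' hc'
      nlinarith [h1, h4, Nat.zero_le (b * (b * c))]

/-- **Rectangle lemma (component-free form).** A 1-rectangle `S × W` of `E_t` — every triangle of `W`
monochromatic under every row of `S` — has `2·|S|·|W| ≤ N = #rows`. -/
theorem two_mul_card_rect_le (S : Finset (Row t)) (W : Finset (Col t))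
    (hS : ∀ x ∈ S, ∀ w ∈ W, Mono x w) : 2 * (S.card * W.card) ≤ Fintype.card (Row t) := by
  have hS' : ∀ x ∈ S, ∀ w ∈ W, ∀ a b : Fin 3, x a (w a) = x b (w b) :=
    fun x hx w hw => (hS x hx w hw).all_eq
  have hW := card_le_prod_card_image W
  -- the three two-coordinate flip bounds
  have h12 := card_mul_two_pow_le 1 2 0 (by decide) (by decide) (by decide) S W hS'
  have h02 := card_mul_two_pow_le 0 2 1 (by decide) (by decide) (by decide) S W hS'
  have h01 := card_mul_two_pow_le 0 1 2 (by decide) (by decide) (by decide) S W hS'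
  generalize (W.image fun w => w 0).card = k0 at hW h01 h02
  generalize (W.image fun w => w 1).card = k1 at hW h01 h12
  generalize (W.image fun w => w 2).card = k2 at hW h02 h12
  -- case on which k is minimal
  rcases le_total k0 k1 with h01' | h10'
  · rcases le_total k0 k2 with h02' | h20'
    · -- k0 minimal: use h12
      have ha : 2 * (k0 * (k1 * k2)) ≤ 2 ^ (k1 + k2) := two_mul_mul_mul_le_two_pow k0 k1 k2 h01' h02'
      calc 2 * (S.card * W.card) ≤ S.card * (2 * (k0 * (k1 * k2))) := by nlinarith
        _ ≤ S.card * 2 ^ (k1 + k2) := Nat.mul_le_mul_left _ ha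
        _ = S.card * (2 ^ k1 * 2 ^ k2) := by rw [pow_add]
        _ ≤ _ := h12
    · -- k2 minimal (k2 ≤ k0 ≤ k1): use h01
      have ha : 2 * (k2 * (k0 * k1)) ≤ 2 ^ (k0 + k1) := two_mul_mul_mul_le_two_pow k2 k0 k1 h20' (h20'.trans h01')
      calc 2 * (S.card * W.card) ≤ S.card * (2 * (k2 * (k0 * k1))) := by nlinarith
        _ ≤ S.card * 2 ^ (k0 + k1) := Nat.mul_le_mul_left _ ha
        _ = S.card * (2 ^ k0 * 2 ^ k1) := by rw [pow_add]
        _ ≤ _ := h01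
  · rcases le_total k1 k2 with h12' | h21'
    · -- k1 minimal: use h02
      have ha : 2 * (k1 * (k0 * k2)) ≤ 2 ^ (k0 + k2) := two_mul_mul_mul_le_two_pow k1 k0 k2 h10' h12'
      calc 2 * (S.card * W.card) ≤ S.card * (2 * (k1 * (k0 * k2))) := by nlinarith
        _ ≤ S.card * 2 ^ (k0 + k2) := Nat.mul_le_mul_left _ ha
        _ = S.card * (2 ^ k0 * 2 ^ k2) := by rw [pow_add]
        _ ≤ _ := h02
    · -- k2 minimal (k2 ≤ k1 ≤ k0): use h01
      have ha : 2 * (k2 * (k0 * k1)) ≤ 2 ^ (k0 + k1) := two_mul_mul_mul_le_two_pow k2 k0 k1 (h21'.trans h10') h21'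
      calc 2 * (S.card * W.card) ≤ S.card * (2 * (k2 * (k0 * k1))) := by nlinarith
        _ ≤ S.card * 2 ^ (k0 + k1) := Nat.mul_le_mul_left _ ha
        _ = S.card * (2 ^ k0 * 2 ^ k1) := by rw [pow_add]
        _ ≤ _ := h01

/-- **Registered sub-goal `minimal_instance_junta` (stmt-PneNP-10680): the ε = 0 endpoint of the minimal instance,**
`rk₊(M_t) ≤ 3t²` as an explicit `ℝ^{3t²}_{≥0}` cone factorisation. -/
theorem minimal_instance_junta : ∀ t : ℕ, HasConeFact (triLift t) 0 (3 * (t * t)) :=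
  hasConeFact_triLift

end

end Summit.PneNP.PneNP.Theorems.XorDoor.Minimal
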